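import Literature.Analysis.FluidPDE.SawtoothCascade
import Literature.Analysis.FluidPDE.SawtoothClosureMargin
import Literature.Analysis.FluidPDE.AnomalousDissipation
import Literature.Analysis.FluidPDE.TwoHalfNavierStokes
import Literature.Analysis.FluidPDE.PassiveVector
import Literature.Analysis.FluidPDE.PassiveScalar
import Literature.Analysis.FunctionSpaces.TorusClassicalNSForceStability
import HarnessLib

/-!
# The drift-free closure objects of the sawtooth pulse cascade (Grenier's approximate-solution scheme; definitions)

Cell `ad-ideate`, seat ad-p2 (tenure planner g7), route `SawtoothPulseCascade`, crux `K3LocalisedClosure`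
(K3loc, stmt-AnomalousDissipation-19492): the `§Defs` block of the REGISTERED line `DriftFree` v2
(`HOME/ad-ideate-p2/route/lines/K3LocalisedClosure_driftfree_v2.lean`, farm rc 0) — copied VERBATIM into the
tree so that the planner can split the crux at route level into `Packaging58 / HalfPulse58 / ApproxSol58 /
DriftFreeClosure58` with these predicates importable (tribunal J addendum-1 (3)).  Same precedent as
`SawtoothClosureMargin` (p429181) and `TorusClassicalNSForceStability` (p437563).  No new mathematics, no named
fact, no axiom, no `sorry`; three elementary glue lemmas are proved.

**The objects** (all on the flat tori `𝕋² = UnitAddTorus (Fin 2)`, `𝕋³`; `ū = P.field` the cascade field of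
`SawtoothCascade`, `θ₀ = datum = sin 2πx₁`):

* the explicit data of the `2½`-dimensional construction (Johansson–Sorella's lift `u = (V, θ) ∘ π` of a planar
  velocity and a planar passive scalar to a solution of 3D Navier–Stokes, §10): the planar force
  `planarForce P = ∂ₜū` on `[0,1)` (extended by `0`), its lift `liftedForce P = (∂ₜū, 0) ∘ π`, the datum
  `liftedDatum = (0, 0, sin 2πx₁) ∘ π`; the packaging predicates `ConstructionRegular`, `PlanarAnomalousFamily`,
  `LiftClassical`, `Existence` (shared verbatim with the registered line `Loc58`);
* the predicates of Grenier's scheme (CPAM 53 (2000), §2–3: write the viscous solution as an APPROXIMATE solution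
  built from linear problems plus a remainder controlled by the crude energy method against the approximate
  solution's strain): `horizon`, `StrainBoundedBy`, the Duhamel–Grönwall defect functional `duhamelDefect`,
  `NSEnergyStability` (energy stability of classical forced Navier–Stokes about a strained reference solution
  with a force defect — Majda–Bertozzi §3.1.1 Prop. 3.1 in Duhamel form; PROVED here, `nsEnergyStability`, by
  the tree's `Torus.IsClassicalNSSolutionOn.sqrt_vectorL2Sq_sub_le_duhamel_fin_two`), `HalfPulseEnergyBound P`
  (the line's closed form is `∀ P, HalfPulseEnergyBound P`), `ApproximateSolution P r`;
* the drift-free window `DriftFreeWindow58 : ∀ γ ∈ [5,8], 3e^{σ⋆γ} < γ² − 3` — PROVED (`driftFreeWindow58`) from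
  the tree's window `SawtoothCascade.closureMargin58` (`3e^{σ⋆γ}‖B(γ)‖ < (γ²−3)²`) and `‖B(γ)‖ ≥ γ² + 1`
  (`envelope_ge` = `SawtoothCascade.one_add_sq_le_envelope`); the hypothesis-carrying forms
  `cap_lt_rate_of_margin`, `driftFreeWindow58_of_margin` of the line are kept, with the route item
  `ClosureMargin58` spelled out (it is definitionally the statement of `closureMargin58`).

`LiftClassical` is PROVED (`liftClassical`, from the tree's `Torus.isClassicalNSSolutionOn_twoHalf`).

Left OUT on purpose (route side): the line's `boxP` and its closed box statement `ApproximateSolution58` — an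
OBLIGATION of the route, not a published result, spelled there as
`∀ γ ∈ Set.Icc (5:ℝ) 8, ∀ ρN ∈ Finset.Icc 2 7, DriftFree.ApproximateSolution ⟨γ, 1/4, 2, 1, ρN⟩ (γ ^ 2 - 3)`
(the pattern of `K1FixedFraction P` / item `K1BoundedStrainCascade`) — and every stub / composition
(`stub_packaging`, `stub_halfPulse`, `stub_approximateSolution`, `stub_driftFreeClosure`, `K3LocalisedClosure_of`).

WHAT THIS IS NOT: no statement here asserts that an approximate solution exists, that the half-pulse bound holds,
or that the closure holds; these are receptacles (predicates of the parameter point) plus three proved facts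
(`liftClassical`, `nsEnergyStability`, `driftFreeWindow58`); the file introduces no unproved closed `Prop`.
[cite: Grenier2000, §2–3 (approximate solution + energy estimate on the remainder)]
[cite: JohanssonSorella2024, §10 (proof of Thm. 1.5: the (2+½)-dimensional Navier–Stokes lift), p. 45]
[cite: MajdaBertozziCUP2002, §3.1.1 Lemma 3.1 and Prop. 3.1 (3.7) (energy method)]
[cite: BrueDeLellisCMP2023, §2 Question 2.1 (the target)] [problem: turb]
-/

open scoped InnerProductSpace ENNReal NNReal
open MeasureTheory Set Filter
open Literature.Analysis Literature.Analysis.FunctionSpaces Literature.Analysis.FluidPDE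
open Literature.Analysis.FunctionSpaces.Torus (twoHalf planarProj)

namespace Literature.Analysis.FluidPDE.SawtoothCascade.DriftFree

/-! ## Packaging layer (verbatim from the registered lines `Loc58` / `DriftFree`) -/

/-- The planar force `G = ∂ₜū` on `[0,1)`, extended by `0` from `t = 1` on (ν-independent).
[cite: JohanssonSorella2024, §10 (proof of Thm. 1.5), p. 45] -/
noncomputable def planarForce (P : CascadeParams) (t : ℝ) (y : UnitAddTorus (Fin 2)) :
    EuclideanSpace ℝ (Fin 2) :=
  if t < 1 then FunctionSpaces.Torus.timeDerivWithin (Ico (0 : ℝ) 1) P.field t y else 0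

/-- Its `2½`-D lift `f = (G, 0) ∘ π` on `T³`. [cite: JohanssonSorella2024, §10 (proof of Thm. 1.5), p. 45] -/
noncomputable def liftedForce (P : CascadeParams) (t : ℝ) : UnitAddTorus (Fin 3) → EuclideanSpace ℝ (Fin 3) :=
  twoHalf (planarForce P t) 0

/-- The common smooth datum `u₀ = (0, 0, sin 2πx₁) ∘ π`. [cite: JohanssonSorella2024, §10 (proof of Thm. 1.5), p. 45] -/
noncomputable def liftedDatum : UnitAddTorus (Fin 3) → EuclideanSpace ℝ (Fin 3) := twoHalf 0 datum

/-- Regularity package of the explicit data: smooth datum, force jointly smooth on `[0,1) × 𝕋³` and bounded and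
continuous in every Hölder norm `C^α`, `α < 1`, up to `t = 1`.
[cite: BrueDeLellisCMP2023, §2 Question 2.1 (smooth on the half-open interval, Hölder up to the endpoint)] -/
def ConstructionRegular (P : CascadeParams) : Prop :=
  FunctionSpaces.Torus.IsSmooth liftedDatum ∧
  FunctionSpaces.Torus.IsSmoothSpaceTimeOn (Ico (0 : ℝ) 1) (liftedForce P) ∧
  ∀ α : ℝ≥0, α < 1 →
    (∃ C : ℝ≥0∞, C < ∞ ∧ ∀ t ∈ Icc (0 : ℝ) 1, eBoundedHolderNorm α (liftedForce P t) ≤ C) ∧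
    ContinuousInHolderOn (Icc 0 1) α (liftedForce P)

/-- The planar anomalous family: along some vanishing viscosity sequence, classical planar Navier–Stokes solutions
`V_m` forced by `planarForce P` from rest, the scalars `R_m` they transport with diffusivity `ν_m` from `datum`,
whose lifts `(V_m, R_m) ∘ π` are weak forced Navier–Stokes solutions on `[0,1]` with anomalous dissipation.
[cite: JohanssonSorella2024, §10 (proof of Thm. 1.5), p. 45] [cite: BrueDeLellisCMP2023, §2 Question 2.1] -/
def PlanarAnomalousFamily (P : CascadeParams) : Prop :=
  ∃ ν : ℕ → ℝ, IsVanishingViscosity ν ∧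
    ∃ (V : ℕ → ℝ → UnitAddTorus (Fin 2) → EuclideanSpace ℝ (Fin 2)) (φ R : ℕ → ℝ → UnitAddTorus (Fin 2) → ℝ),
      (∀ m, FunctionSpaces.Torus.IsClassicalNSSolutionOn (Ico (0 : ℝ) 1) (ν m) (planarForce P) (V m) (φ m) ∧
          V m 0 = 0 ∧
          FluidPDE.Torus.IsClassicalScalarTransportOn (Ico (0 : ℝ) 1) (ν m) (V m) (R m) ∧ R m 0 = datum ∧
          FluidPDE.Torus.IsWeakNSSolutionForcedOn 1 (ν m) (liftedForce P) liftedDatum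
            (fun t => twoHalf (V m t) (R m t))) ∧
      HasAnomalousDissipation ν (fun m t => twoHalf (V m t) (R m t))

/-- Classical `2½`-D packaging: a classical planar Navier–Stokes solution and a classical scalar it transports lift
to a classical solution of 3D Navier–Stokes with the lifted force. [cite: JohanssonSorella2024, §10 (proof of Thm. 1.5), p. 45] -/
def LiftClassical : Prop :=
  ∀ (P : CascadeParams) (ν : ℝ) (V : ℝ → UnitAddTorus (Fin 2) → EuclideanSpace ℝ (Fin 2))
    (φ R : ℝ → UnitAddTorus (Fin 2) → ℝ),
    FunctionSpaces.Torus.IsClassicalNSSolutionOn (Ico (0 : ℝ) 1) ν (planarForce P) V φ →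
    FluidPDE.Torus.IsClassicalScalarTransportOn (Ico (0 : ℝ) 1) ν V R →
    FunctionSpaces.Torus.IsClassicalNSSolutionOn (Ico (0 : ℝ) 1) ν (liftedForce P)
      (fun t => twoHalf (V t) (R t)) (fun t => φ t ∘ planarProj)

/-- Existence package for fixed `ν > 0`: a classical planar Navier–Stokes solution forced by `planarForce P` from
rest with its transported scalar from `datum`, whose lift is a weak forced solution on `[0,1]`, and a classical
scalar transported by the cascade field itself. [cite: JohanssonSorella2024, §10 (proof of Thm. 1.5), p. 45] -/
def Existence (P : CascadeParams) : Prop :=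
  ∀ ν : ℝ, 0 < ν →
    (∃ (V : ℝ → UnitAddTorus (Fin 2) → EuclideanSpace ℝ (Fin 2)) (φ R : ℝ → UnitAddTorus (Fin 2) → ℝ),
      FunctionSpaces.Torus.IsClassicalNSSolutionOn (Ico (0 : ℝ) 1) ν (planarForce P) V φ ∧ V 0 = 0 ∧
      FluidPDE.Torus.IsClassicalScalarTransportOn (Ico (0 : ℝ) 1) ν V R ∧ R 0 = datum ∧
      FluidPDE.Torus.IsWeakNSSolutionForcedOn 1 ν (liftedForce P) liftedDatum (fun t => twoHalf (V t) (R t))) ∧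
    ∃ w : ℝ → UnitAddTorus (Fin 2) → ℝ,
      FluidPDE.Torus.IsClassicalScalarTransportOn (Ico (0 : ℝ) 1) ν P.field w ∧ w 0 = datum

/-! ## The predicates of Grenier's scheme (line `DriftFree`) -/

/-- The localised horizon `T_A(ν) = tStart (J_r(ν) + A)` (the time by which the route's item `K1loc` dissipates its
fixed fraction; `< 1` by `CascadeParams.tStart_lt_one`). [folklore] -/
noncomputable def horizon (r ν : ℝ) (A : ℕ) : ℝ := CascadeParams.tStart (Jrate r ν + A)

/-- Pointwise bound of the strain (symmetric velocity gradient) of `U` on the time set `I`: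
`⟪ξ, (ξ·∇)U(t,x)⟫ ≤ Λ(t) ‖ξ‖²` for all `x`, `ξ` (for a shear `a U(x₂) e₁` with `|U'| ≤ 1`: `Λ = a/2`) — the
rate entering the energy estimate of the remainder. [cite: MajdaBertozziCUP2002, §3.1.1 Prop. 3.1 (3.7) (the velocity-gradient rate)] -/
def StrainBoundedBy (U : ℝ → UnitAddTorus (Fin 2) → EuclideanSpace ℝ (Fin 2)) (Λ : ℝ → ℝ) (I : Set ℝ) : Prop :=
  ∀ t ∈ I, ∀ (x : UnitAddTorus (Fin 2)) (ξ : EuclideanSpace ℝ (Fin 2)),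
    ⟪ξ, FunctionSpaces.Torus.convect (fun _ => ξ) (U t) x⟫_ℝ ≤ Λ t * ‖ξ‖ ^ 2

/-- The Duhamel–Grönwall defect functional `∫₀ᵗ e^{∫ₛᵗ Λ⁺} ‖ρ(s)‖_{L²} ds` (each source is amplified only from
its own injection time on — the form the phase bookkeeping needs; the cruder `e^{∫₀ᵀΛ⁺}∫‖ρ‖` does NOT close).
[folklore] -/
noncomputable def duhamelDefect (Λ : ℝ → ℝ) (ρ : ℝ → UnitAddTorus (Fin 2) → EuclideanSpace ℝ (Fin 2))
    (t : ℝ) : ℝ :=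
  ∫ s in (0 : ℝ)..t, Real.exp (∫ τ in s..t, max (Λ τ) 0) * Real.sqrt (FluidPDE.Torus.vectorL2Sq (ρ s))

/-- ENERGY STABILITY of classical forced Navier–Stokes about a reference solution with a force defect (the
remainder step of Grenier's scheme): `U` solves NS with force `f + ρ`, `V` with force `f`, `U(0) = V(0)`, the
strain of `U` is bounded by `Λ`; then `‖V(t) − U(t)‖_{L²} ≤ ∫₀ᵗ e^{∫ₛᵗ Λ⁺} ‖ρ(s)‖_{L²} ds`
(`R = V − U`: `d/dt ½‖R‖² + ν‖∇R‖² = −⟨R,(R·∇)U⟩ − ⟨ρ,R⟩`, the transport terms `⟨R,(V·∇)R⟩` vanish).  A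
THEOREM: `nsEnergyStability`. [cite: MajdaBertozziCUP2002, §3.1.1 Lemma 3.1 and Prop. 3.1 (3.7)]
[cite: Grenier2000, §2 (energy estimate on the remainder)] -/
def NSEnergyStability : Prop :=
  ∀ (S : Set ℝ) (ν T : ℝ) (f ρ U V : ℝ → UnitAddTorus (Fin 2) → EuclideanSpace ℝ (Fin 2))
    (qU qV : ℝ → UnitAddTorus (Fin 2) → ℝ) (Λ : ℝ → ℝ),
    0 ≤ ν → 0 ≤ T → Convex ℝ S → Icc 0 T ⊆ S →
    FunctionSpaces.Torus.IsClassicalNSSolutionOn S ν (f + ρ) U qU →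
    FunctionSpaces.Torus.IsClassicalNSSolutionOn S ν f V qV → U 0 = V 0 →
    StrainBoundedBy U Λ (Icc 0 T) → ContinuousOn Λ (Icc 0 T) →
    ContinuousOn (fun s => Real.sqrt (FluidPDE.Torus.vectorL2Sq (ρ s))) (Icc 0 T) →
    ∀ t ∈ Icc 0 T, Real.sqrt (FluidPDE.Torus.vectorL2Sq (V t - U t)) ≤ duhamelDefect Λ ρ t

/-- Crude operator bound for the linearised flow over ONE half pulse at the parameter point `P` (energy method;
the line's closed `HalfPulseEnergyBound` is `∀ P, HalfPulseEnergyBound P`, verbatim up to currying): a weak passive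
vector transported by the cascade field `P.field` over the half pulse `(j₀, hz)` grows in `L²` by at most `e^{γ}`.
[cite: MajdaBertozziCUP2002, §3.1.1 Prop. 3.1 (3.7) (energy growth by the velocity-gradient rate)] -/
def HalfPulseEnergyBound (P : CascadeParams) : Prop :=
  ∀ (ν : ℝ) (j₀ : ℕ) (hz : Bool)
    (w₀ : UnitAddTorus (Fin 2) → EuclideanSpace ℝ (Fin 2)) (w : ℝ → UnitAddTorus (Fin 2) → EuclideanSpace ℝ (Fin 2)),
    0 < ν → 0 ≤ P.γ → 0 < P.δ₀ → 1 ≤ P.d → MemLp w₀ 2 volume →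
    FluidPDE.Torus.IsWeakPassiveVectorOn 1 (CascadeParams.tHalf j₀) ν
        (fun t => P.field (CascadeParams.tInject j₀ hz + t)) w₀ w →
      ∀ᵐ t ∂(volume.restrict (Ioo 0 (CascadeParams.tHalf j₀))),
        FluidPDE.Torus.vectorL2Sq (w t) ≤ Real.exp P.γ * FluidPDE.Torus.vectorL2Sq w₀

/-- APPROXIMATE SOLUTION on the localised window (Grenier's scheme, order left to the prover): for every `A` and
`ε > 0`, for all small `ν`, there is a classical solution `U` of Navier–Stokes with force `∂ₜū + ρ` from rest on
`[0,1)` such that, with `T = horizon r ν A`: (a) `∫₀ᵀ ‖U − ū‖²_{L²} ≤ ε ν` (closeness to the carrier, the scalar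
side's cost); (b) its strain is bounded by a continuous `Λ` and its defect `ρ` obeys
`(∫₀ᵗ e^{∫ₛᵗΛ⁺}‖ρ(s)‖ ds)² ≤ ε ν` for `t ≤ T` (the remainder's cost).  The carrier itself (`U = ū`, `ρ = −νΔū`)
does NOT qualify (`e^{γ}` per phase); `U = ū + L` with `L` the LINEARISED response is the intended witness.
[cite: Grenier2000, §2–3 (approximate solution built from linear problems, remainder by energy)] -/
def ApproximateSolution (P : CascadeParams) (r : ℝ) : Prop :=
  ∀ A : ℕ, ∀ ε : ℝ, 0 < ε → ∃ ν₀ : ℝ, 0 < ν₀ ∧ ∀ ν ∈ Ioc 0 ν₀,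
    ∃ (U ρ : ℝ → UnitAddTorus (Fin 2) → EuclideanSpace ℝ (Fin 2)) (q : ℝ → UnitAddTorus (Fin 2) → ℝ)
      (Λ : ℝ → ℝ),
      FunctionSpaces.Torus.IsClassicalNSSolutionOn (Ico (0 : ℝ) 1) ν (planarForce P + ρ) U q ∧ U 0 = 0 ∧
      StrainBoundedBy U Λ (Icc 0 (horizon r ν A)) ∧ ContinuousOn Λ (Icc 0 (horizon r ν A)) ∧
      ContinuousOn (fun s => Real.sqrt (FluidPDE.Torus.vectorL2Sq (ρ s))) (Icc 0 (horizon r ν A)) ∧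
      ContinuousOn (fun s => FluidPDE.Torus.vectorL2Sq (U s - P.field s)) (Icc 0 (horizon r ν A)) ∧
      (∫ s in (0 : ℝ)..horizon r ν A, FluidPDE.Torus.vectorL2Sq (U s - P.field s)) ≤ ε * ν ∧
      ∀ t ∈ Icc 0 (horizon r ν A), duhamelDefect Λ ρ t ^ 2 ≤ ε * ν

/-! ## The drift-free window (proved) -/

/-- The drift-free closure window on the box: the Kelvin–Helmholtz cap `3e^{σ⋆γ}` per phase is below the per-pair
stretching rate `γ² − 3`, for every `γ ∈ [5, 8]`.  A THEOREM: `driftFreeWindow58`.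
[cite: Drazin2002, §8.3 Example 8.3 and Exercise 8.10 (σ⋆)] [cite: ElgindiLissMattingly2025, §3.1 Lemma 3.1 (the per-pair growth)] -/
def DriftFreeWindow58 : Prop :=
  ∀ γ ∈ Icc (5 : ℝ) 8, 3 * Real.exp (sawSigmaStar * γ) < γ ^ 2 - 3

/-- `γ² + 1 ≤ ‖B(γ)‖ = ((γ²+2) + √((γ²+2)²−4))/2` — the tree's `one_add_sq_le_envelope`, in the line's spelling.
[cite: ElgindiLissMattingly2025, §1.2.2 (eigenvalues c_α, 1/c_α of the matrices A_i)] -/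
theorem envelope_ge (γ : ℝ) : γ ^ 2 + 1 ≤ ((γ ^ 2 + 2) + Real.sqrt ((γ ^ 2 + 2) ^ 2 - 4)) / 2 := by
  simpa only [add_comm] using one_add_sq_le_envelope γ

/-- The window `3e^{σ⋆γ}‖B(γ)‖ < (γ² − 3)²` on `[5, 8]` (the route item `ClosureMargin58`, spelled out) implies the
drift-free window `3e^{σ⋆γ} < γ² − 3` at each `γ ∈ [5, 8]` (since `‖B(γ)‖ ≥ γ² + 1 > γ² − 3`).
[cite: Drazin2002, §8.3 Example 8.3 and Exercise 8.10 (σ⋆)] [cite: BrueDeLellisCMP2023, §2 Question 2.1] -/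
theorem cap_lt_rate_of_margin
    (hW : ∀ γ ∈ Icc (5 : ℝ) 8, 3 * Real.exp (sawSigmaStar * γ) *
      (((γ ^ 2 + 2) + Real.sqrt ((γ ^ 2 + 2) ^ 2 - 4)) / 2) < (γ ^ 2 - 3) ^ 2)
    {γ : ℝ} (hγ : γ ∈ Icc (5 : ℝ) 8) :
    3 * Real.exp (sawSigmaStar * γ) < γ ^ 2 - 3 := by
  have h := hW γ hγ
  have hE : 0 < 3 * Real.exp (sawSigmaStar * γ) := by positivity
  have h1 : 3 * Real.exp (sawSigmaStar * γ) * (γ ^ 2 + 1) < (γ ^ 2 - 3) ^ 2 :=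
    lt_of_le_of_lt (mul_le_mul_of_nonneg_left (envelope_ge γ) hE.le) h
  have hγ5 : (5 : ℝ) ≤ γ := hγ.1
  have hr : 0 < γ ^ 2 - 3 := by nlinarith
  rcases lt_or_ge (3 * Real.exp (sawSigmaStar * γ)) (γ ^ 2 - 3) with hlt | hc
  · exact hlt
  · exfalso
    have h2 : (γ ^ 2 - 3) * (γ ^ 2 + 1) ≤ 3 * Real.exp (sawSigmaStar * γ) * (γ ^ 2 + 1) :=
      mul_le_mul_of_nonneg_right hc (by positivity)
    nlinarith

/-- The window `ClosureMargin58` (spelled out) implies `DriftFreeWindow58`.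
[cite: Drazin2002, §8.3 Example 8.3 and Exercise 8.10 (σ⋆)] [cite: BrueDeLellisCMP2023, §2 Question 2.1] -/
theorem driftFreeWindow58_of_margin
    (hW : ∀ γ ∈ Icc (5 : ℝ) 8, 3 * Real.exp (sawSigmaStar * γ) *
      (((γ ^ 2 + 2) + Real.sqrt ((γ ^ 2 + 2) ^ 2 - 4)) / 2) < (γ ^ 2 - 3) ^ 2) :
    DriftFreeWindow58 :=
  fun _ hγ => cap_lt_rate_of_margin hW hγ

/-- **The drift-free window holds**: `3e^{σ⋆γ} < γ² − 3` for every `γ ∈ [5, 8]` — from the tree's proved window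
`SawtoothCascade.closureMargin58`. [cite: Drazin2002, §8.3 Example 8.3 and Exercise 8.10 (σ⋆)]
[cite: BrueDeLellisCMP2023, §2 Question 2.1 (the target the window serves)] -/
theorem driftFreeWindow58 : DriftFreeWindow58 :=
  driftFreeWindow58_of_margin closureMargin58

/-! ## The classical `2½`-D lift (proved) -/

/-- **`LiftClassical` holds**: the tree's packaging theorem `Torus.isClassicalNSSolutionOn_twoHalf` (Cheskidov
2023 (3.13); Johansson–Sorella §10) with the force identified slice-wise — the planar part of `twoHalfForce` is
`planarForce P` by the momentum equation of `V`, the vertical part vanishes by the transport equation of `R`.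
[cite: JohanssonSorella2024, §10 (proof of Thm. 1.5), p. 45] [cite: Cheskidov2023, §3 (3.12)–(3.13)] -/
theorem liftClassical : LiftClassical := by
  intro P ν V φ R hV hR
  have h := FluidPDE.Torus.isClassicalNSSolutionOn_twoHalf (uniqueDiffOn_Ico (0 : ℝ) 1) ν
    hV.smooth_velocity hR.smooth_scalar hV.smooth_pressure hV.divFree
  have hF : ∀ t ∈ Ico (0 : ℝ) 1, FluidPDE.Torus.twoHalfForce (Ico (0 : ℝ) 1) ν V R φ t = liftedForce P t := by
    intro t ht
    show twoHalf _ _ = twoHalf _ _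
    congr 1
    · funext y
      rw [hV.momentum t ht y]
      abel
    · funext y
      rw [hR.transport t ht y]
      simp
  exact ⟨h.smooth_velocity, h.smooth_pressure,
    fun t ht x => by rw [← hF t ht]; exact h.momentum t ht x, h.divFree⟩

/-! ## Energy stability (proved) -/

/-- **`NSEnergyStability` holds**: energy stability of classical forced Navier–Stokes about a strained reference
solution with a force defect, Duhamel–Grönwall form — the tree's
`Torus.IsClassicalNSSolutionOn.sqrt_vectorL2Sq_sub_le_duhamel_fin_two` (rate = one-sided strain bound; the
hypotheses `0 ≤ T`, `Convex ℝ S` and the continuity of `‖ρ‖` are not used by it).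
[cite: MajdaBertozziCUP2002, §3.1.1 Lemma 3.1 and Prop. 3.1 (3.7)] -/
theorem nsEnergyStability : NSEnergyStability :=
  fun _ _ _ _ _ _ _ _ _ _ hν _ _ hST hU hV h0 hΛ hΛc _ _ ht =>
    FunctionSpaces.Torus.IsClassicalNSSolutionOn.sqrt_vectorL2Sq_sub_le_duhamel_fin_two
      hν hST hU hV h0 hΛ hΛc ht

end Literature.Analysis.FluidPDE.SawtoothCascade.DriftFree

/-! ## `_holds` aliases (appended 2026-08-28)

The named fact(s) below are already theorems of the tree under another name; the `_holds`
alias records the discharge under the tree's naming convention (D-0026 bookkeeping: proof term =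
the existing theorem, no statement or definition edited). -/

/-- `DriftFreeWindow58` is a theorem of the tree (`Literature.Analysis.FluidPDE.SawtoothCascade.DriftFree.driftFreeWindow58`). [cite: Drazin2002, §8.3 Example 8.3 and Exercise 8.10 (σ⋆)] [cite: ElgindiLissMattingly2025, §3.1 Lemma 3.1 (the per-pair growth)] -/
theorem _root_.Literature.Analysis.FluidPDE.SawtoothCascade.DriftFree.DriftFreeWindow58_holds : _root_.Literature.Analysis.FluidPDE.SawtoothCascade.DriftFree.DriftFreeWindow58 :=
  _root_.Literature.Analysis.FluidPDE.SawtoothCascade.DriftFree.driftFreeWindow58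

/-- `LiftClassical` is a theorem of the tree (`Literature.Analysis.FluidPDE.SawtoothCascade.DriftFree.liftClassical`). [cite: JohanssonSorella2024, §10 (proof of Thm. 1.5), p. 45] -/
theorem _root_.Literature.Analysis.FluidPDE.SawtoothCascade.DriftFree.LiftClassical_holds : _root_.Literature.Analysis.FluidPDE.SawtoothCascade.DriftFree.LiftClassical :=
  _root_.Literature.Analysis.FluidPDE.SawtoothCascade.DriftFree.liftClassical

/-- `NSEnergyStability` is a theorem of the tree (`Literature.Analysis.FluidPDE.SawtoothCascade.DriftFree.nsEnergyStability`). [cite: MajdaBertozziCUP2002, §3.1.1 Lemma 3.1 and Prop. 3.1 (3.7)] [cite: Grenier2000, §2 (energy estimate on the remainder)] -/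
theorem _root_.Literature.Analysis.FluidPDE.SawtoothCascade.DriftFree.NSEnergyStability_holds : _root_.Literature.Analysis.FluidPDE.SawtoothCascade.DriftFree.NSEnergyStability :=
  _root_.Literature.Analysis.FluidPDE.SawtoothCascade.DriftFree.nsEnergyStability
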